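import Mathlib.NumberTheory.Padics.PadicNumbers
import Mathlib.NumberTheory.Multiplicity
import Mathlib.NumberTheory.Padics.PadicVal.Basic

/-!
# Stub T (`stub_normOneAddPowSubOne`) of line `ratio_measure_strassmann` for crux `TangentCone.EdgeCap` (stmt-BirchSwinnertonDyer-17609)

Target: `Summits/BirchSwinnertonDyer/BirchSwinnertonDyer/Theorems/TangentConeEdgeCapStubNormOneAddPowSubOne.lean`
(`ledger propose --target <that> --file work/stubs/stub_normOneAddPowSubOne.lean --supports stmt-BirchSwinnertonDyer-17609`).
The theorem name and signature below are REGISTERED on the crux item; do not change them.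
-/

-- The directory layout `Summits/BirchSwinnertonDyer/BirchSwinnertonDyer/…` forces the duplicated segment.
set_option linter.dupNamespace false

noncomputable section

namespace Summit.BirchSwinnertonDyer.BirchSwinnertonDyer.Theorems

/-- **Stub T (`stub_normOneAddPowSubOne`) of line `ratio_measure_strassmann` for crux `TangentCone.EdgeCap` (stmt-BirchSwinnertonDyer-17609):** `‖(1+p)^n − 1‖_p ≤ ‖p‖_p ‖n‖_p` for odd `p` (lifting the exponent). -/
theorem stub_normOneAddPowSubOne :
    ∀ (p : ℕ) [Fact p.Prime], p ≠ 2 → ∀ n : ℕ, ‖(1 + (p : ℚ_[p])) ^ n - 1‖ ≤ ‖(p : ℚ_[p])‖ * ‖(n : ℚ_[p])‖ := by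
  intro p hp hp2 n
  rcases Nat.eq_zero_or_pos n with rfl | hn
  · simp
  have hpp : p.Prime := hp.out
  have hp_pos : 0 < p := hpp.pos
  have hp1 : Odd p := hpp.odd_of_ne_two hp2
  have hndvd : ¬p ∣ 1 + p := by
    rw [Nat.dvd_add_self_right, Nat.dvd_one]
    exact hpp.one_lt.ne'
  -- Lifting the exponent: `v_p((1+p)^n - 1) = v_p(p) + v_p(n) = 1 + v_p(n)`.
  have hval : padicValNat p ((1 + p) ^ n - 1) = 1 + padicValNat p n := by
    have h := padicValNat.pow_sub_pow hp1 (show 1 < 1 + p by omega) (by simp) hndvd hn.ne'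
    simpa [padicValNat_self] using h
  have h1 : 1 ≤ (1 + p) ^ n := Nat.one_le_pow _ _ (by omega)
  have hm0 : ((1 + p) ^ n - 1 : ℕ) ≠ 0 := by
    have : 1 < (1 + p) ^ n := Nat.one_lt_pow hn.ne' (by omega)
    omega
  have hcast : (1 + (p : ℚ_[p])) ^ n - 1 = (((1 + p) ^ n - 1 : ℕ) : ℚ_[p]) := by
    push_cast [Nat.cast_sub h1]
    ring
  have hp0 : (p : ℝ) ≠ 0 := by exact_mod_cast hpp.ne_zero
  have hLHS : ‖(1 + (p : ℚ_[p])) ^ n - 1‖ = (p : ℝ) ^ (-(1 + padicValNat p n : ℤ)) := by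
    rw [hcast, Padic.norm_eq_zpow_neg_valuation (by exact_mod_cast hm0), Padic.valuation_natCast,
      hval]
    push_cast
    rfl
  have hRHS : ‖(n : ℚ_[p])‖ = (p : ℝ) ^ (-(padicValNat p n : ℤ)) := by
    rw [Padic.norm_eq_zpow_neg_valuation (by exact_mod_cast hn.ne'), Padic.valuation_natCast]
  calc ‖(1 + (p : ℚ_[p])) ^ n - 1‖ = (p : ℝ) ^ (-(1 + padicValNat p n : ℤ)) := hLHS
    _ = ‖(p : ℚ_[p])‖ * ‖(n : ℚ_[p])‖ := by
      rw [hRHS, Padic.norm_p, neg_add, zpow_add₀ hp0, zpow_neg_one]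
    _ ≤ ‖(p : ℚ_[p])‖ * ‖(n : ℚ_[p])‖ := le_rfl

end Summit.BirchSwinnertonDyer.BirchSwinnertonDyer.Theorems

end
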